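import Mathlib.Analysis.SpecialFunctions.Integrals.Basic
import Mathlib.Analysis.PSeries
import HarnessLib

/-!
# Hilbert's inequality for separated real sequences

Topic `Literature/NumberTheory/LFunctions`.  An elementary, fully proved form of the (generalised)
Hilbert inequality of Montgomery–Vaughan with an unspecified absolute constant, obtained by the
double-integral device used in Ivić's monograph (after K. Ramachandra) for the classical case.
Throughout, `S ⊆ ℕ` is a finite index set, `u : ℕ → ℝ` are real "frequencies", `a, b : ℕ → ℂ`
coefficients, and the **Hilbert form** is written out in full as
`H_S(a,b) = ∑ m ∈ S, ∑ n ∈ S.erase m, a m * conj (b n) / ((u m - u n : ℝ) : ℂ)`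
(no abbreviation is introduced, so that the file is definition-free).

* `HilbertIneq.integral_norm_sq_sum_exp_eq` — squaring and integrating (Ivić (5.4)):
  `∫_0^T |∑_{n∈S} a_n e^{iu_n x}|² dx = T ∑|a_n|² + ∑_{m≠n} a_m ā_n (e^{i(u_m-u_n)T} - 1)/(i(u_m-u_n))`;
* `HilbertIneq.doubleIntegral_eq` — the identity
  `∫_0^Y ∫_0^y |∑_{n∈S} a_n e^{i u_n x}|² dx dy
     = (Y²/2) ∑ |a_n|² + i Y H_S(a,a) - ∑_{m≠n} a_m ā_n (e^{i(u_m-u_n)Y} - 1)/(u_m-u_n)²`;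
* `HilbertIneq.im_hilbertForm_le` — positivity of the double integral gives the one-sided bound
  `Y · Im H_S(a,a) ≤ (Y²/2) ∑|a_n|² - Re ∑_{m≠n} a_m ā_n (e^{i(u_m-u_n)Y} - 1)/(u_m-u_n)²`
  (Ivić (5.8), (5.11)); `conj H_S(a,a) = -H_S(a,a) = H_S(ā,ā)` supplies the other side;
* `hilbertInequality_of_separated` — **Hilbert's inequality**: if `δ|m-n| ≤ |u_m - u_n|` on `S`
  then `|H_S(a,a)| ≤ (4/δ) ∑_{n∈S} |a_n|²` (Ivić (5.6) has the sharp constant `π` for integer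
  `u_n`; Montgomery–Vaughan 1974 have `π/δ` for arbitrary `δ`-spaced reals);
* `norm_hilbertForm_le_of_separated` — the bilinear form by polarisation,
  `|H_S(a,b)| ≤ (8/δ)(∑|a_n|² + ∑|b_n|²)` (cf. Ivić (5.10), constant `3π`).

These are the inputs for the weighted inequality (Ivić (5.5), `HilbertInequalityLog.lean`) and the
mean value theorem for Dirichlet polynomials (Ivić Thm 5.2, `Ivic1985_theorem52_holds` in
`DirichletPolynomialMeanValueThm52.lean`).

## Design notes

* The separation hypothesis is the "indexed" one, `δ |m - n| ≤ |u_m - u_n|`, which covers integer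
  sequences (`u_n = n`, `δ = 1`) and blocks of `u_n = log n`; the version for an arbitrary
  `δ`-spaced finite set of reals follows by sorting and is not needed here.
* Constants are not optimised (`4/δ` instead of `π/δ`).

## Sources

* A. Ivić, *The Riemann zeta-function* (Wiley 1985; Dover 2003), §5.2, (5.4)–(5.11), pp. 131–133.
* H. L. Montgomery, R. C. Vaughan, *Hilbert's inequality*, J. London Math. Soc. (2) 8 (1974) 73–82.
* K. Ramachandra, *Some remarks on the mean value of the Riemann zeta-function and other Dirichlet
  series* (1980b in Ivić's bibliography).
-/

open Finset Real MeasureTheory Complex intervalIntegral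
open scoped ComplexConjugate

namespace Literature.NumberTheory.LFunctions

namespace HilbertIneq

/-- Expanding the square: `|∑_n c_n|² = ∑_m ∑_n c_m conj(c_n)` as complex numbers. [folklore] -/
lemma ofReal_norm_sq_sum (S : Finset ℕ) (c : ℕ → ℂ) :
    ((‖∑ n ∈ S, c n‖ ^ 2 : ℝ) : ℂ) = ∑ m ∈ S, ∑ n ∈ S, c m * conj (c n) := by
  rw [← Finset.sum_mul_sum, ← map_sum, Complex.mul_conj, Complex.normSq_eq_norm_sq,
    Complex.ofReal_pow]

/-- `e^{ivx} conj(e^{iwx}) = e^{i(v-w)x}` for real `v, w, x`. [folklore] -/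
lemma exp_mul_conj_exp (v w x : ℝ) :
    cexp (↑v * I * ↑x) * conj (cexp (↑w * I * ↑x)) = cexp (↑(v - w) * I * ↑x) := by
  rw [← Complex.exp_conj, ← Complex.exp_add]
  congr 1
  simp only [map_mul, Complex.conj_ofReal, Complex.conj_I]
  push_cast
  ring

/-- Pointwise expansion of `|∑_n a_n e^{i u_n x}|²` as a double sum of phases
`e^{i(u_m - u_n)x}`. [folklore] -/
lemma norm_sq_sum_exp_expand (S : Finset ℕ) (u : ℕ → ℝ) (a : ℕ → ℂ) (x : ℝ) :
    ((‖∑ n ∈ S, a n * cexp (↑(u n) * I * ↑x)‖ ^ 2 : ℝ) : ℂ) =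
      ∑ m ∈ S, ∑ n ∈ S, a m * conj (a n) * cexp (↑(u m - u n) * I * ↑x) := by
  rw [ofReal_norm_sq_sum]
  refine Finset.sum_congr rfl fun m _ => Finset.sum_congr rfl fun n _ => ?_
  rw [map_mul, mul_mul_mul_comm, exp_mul_conj_exp]

/-- `∫_0^y e^{icx} dx = (e^{icy} - 1)/(ic)` for real `c ≠ 0`. [folklore] -/
lemma integral_exp_I_mul {c : ℝ} (hc : c ≠ 0) (y : ℝ) :
    ∫ x in (0 : ℝ)..y, cexp (↑c * I * ↑x) = (cexp (↑c * I * ↑y) - 1) / (↑c * I) := by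
  have hc' : (c : ℂ) * I ≠ 0 := mul_ne_zero (Complex.ofReal_ne_zero.mpr hc) Complex.I_ne_zero
  rw [integral_exp_mul_complex hc']
  simp

/-- `∫_0^Y (e^{icy} - 1)/(ic) dy = ((e^{icY} - 1)/(ic) - Y)/(ic)` for real `c ≠ 0`. [folklore] -/
lemma integral_integral_exp_I_mul {c : ℝ} (hc : c ≠ 0) (Y : ℝ) :
    ∫ y in (0 : ℝ)..Y, (cexp (↑c * I * ↑y) - 1) / (↑c * I) =
      ((cexp (↑c * I * ↑Y) - 1) / (↑c * I) - Y) / (↑c * I) := by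
  rw [intervalIntegral.integral_div, intervalIntegral.integral_sub, integral_exp_I_mul hc,
    intervalIntegral.integral_const]
  · simp
  · exact (by fun_prop : Continuous fun y : ℝ => cexp (↑c * I * ↑y)).intervalIntegrable _ _
  · exact intervalIntegrable_const

/-- The algebra of the off-diagonal terms: `((E-1)/(ic) - Y)/(ic) = iY/c - (E-1)/c²`. [folklore] -/
lemma offDiag_algebra {c : ℝ} (hc : c ≠ 0) (E : ℂ) (Y : ℝ) :
    ((E - 1) / (↑c * I) - Y) / (↑c * I) = I * Y / (c : ℂ) - (E - 1) / ((c ^ 2 : ℝ) : ℂ) := by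
  have hc' : (c : ℂ) ≠ 0 := Complex.ofReal_ne_zero.mpr hc
  have hcI : (c : ℂ) * I ≠ 0 := mul_ne_zero hc' Complex.I_ne_zero
  rw [div_sub' hcI, div_div, show (c : ℂ) * I * ((c : ℂ) * I) = -((c : ℂ) ^ 2) by
    rw [mul_mul_mul_comm, Complex.I_mul_I]; ring]
  push_cast
  field_simp
  ring

/-- Swapping the order of summation over ordered pairs of distinct elements. [folklore] -/
lemma sum_erase_comm {M : Type*} [AddCommMonoid M] (S : Finset ℕ) (f : ℕ → ℕ → M) :
    ∑ m ∈ S, ∑ n ∈ S.erase m, f m n = ∑ n ∈ S, ∑ m ∈ S.erase n, f m n := by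
  apply Finset.sum_comm'
  intro m n
  simp only [Finset.mem_erase]
  tauto

/-- Separation implies injectivity of the frequencies on `S`. [folklore] -/
lemma injOn_of_separated (S : Finset ℕ) (u : ℕ → ℝ) {δ : ℝ} (hδ : 0 < δ)
    (hsep : ∀ m ∈ S, ∀ n ∈ S, δ * |(m : ℝ) - n| ≤ |u m - u n|) : Set.InjOn u S := by
  intro m hm n hn hmn
  by_contra h
  have h1 : (0 : ℝ) < |(m : ℝ) - n| := by
    rw [abs_pos, sub_ne_zero]; exact_mod_cast h
  have := hsep m hm n hn
  rw [hmn, sub_self, abs_zero] at this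
  nlinarith [mul_pos hδ h1]

/-- **Squaring and integrating** (Ivić 1985, (5.4)): for `u` injective on `S` and real `T`,
`∫_0^T |∑_{n∈S} a_n e^{iu_n x}|² dx
   = T ∑_{n∈S} |a_n|² + ∑_{m≠n∈S} a_m ā_n (e^{i(u_m-u_n)T} - 1)/(i(u_m-u_n))`.
[cite: Ivic1985, (5.4)] -/
theorem integral_norm_sq_sum_exp_eq (S : Finset ℕ) (u : ℕ → ℝ) (hu : Set.InjOn u S)
    (a : ℕ → ℂ) (T : ℝ) :
    ((∫ x in (0 : ℝ)..T, ‖∑ n ∈ S, a n * cexp (↑(u n) * I * ↑x)‖ ^ 2 : ℝ) : ℂ) =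
      ((T * ∑ n ∈ S, ‖a n‖ ^ 2 : ℝ) : ℂ) +
        ∑ m ∈ S, ∑ n ∈ S.erase m,
          a m * conj (a n) * (cexp (↑(u m - u n) * I * ↑T) - 1) / (↑(u m - u n) * I) := by
  classical
  have hc : ∀ m ∈ S, ∀ n ∈ S, m ≠ n → u m - u n ≠ 0 := fun m hm n hn hmn =>
    sub_ne_zero.mpr fun h => hmn (hu hm hn h)
  have hcontE : ∀ m n, Continuous fun x : ℝ => cexp (↑(u m - u n) * I * ↑x) := fun m n => by
    fun_prop
  rw [← intervalIntegral.integral_ofReal]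
  simp_rw [norm_sq_sum_exp_expand]
  rw [intervalIntegral.integral_finsetSum]
  · have hrow : ∀ m ∈ S, ∫ x in (0 : ℝ)..T, ∑ n ∈ S, a m * conj (a n) * cexp (↑(u m - u n) * I * ↑x)
        = ((T * ‖a m‖ ^ 2 : ℝ) : ℂ) + ∑ n ∈ S.erase m,
          a m * conj (a n) * (cexp (↑(u m - u n) * I * ↑T) - 1) / (↑(u m - u n) * I) := by
      intro m hm
      rw [intervalIntegral.integral_finsetSum]
      · rw [← Finset.add_sum_erase S _ hm]
        congr 1
        · rw [intervalIntegral.integral_const_mul]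
          simp only [sub_self, Complex.ofReal_zero, zero_mul, Complex.exp_zero,
            intervalIntegral.integral_const, sub_zero, Complex.real_smul, mul_one, Complex.mul_conj,
            Complex.normSq_eq_norm_sq]
          push_cast; ring
        · refine Finset.sum_congr rfl fun n hn => ?_
          have hnm : m ≠ n := fun h => (Finset.mem_erase.mp hn).1 h.symm
          rw [intervalIntegral.integral_const_mul,
            integral_exp_I_mul (hc m hm n (Finset.mem_of_mem_erase hn) hnm) T]
          ring
      · intro n _
        exact ((hcontE m n).const_mul _).intervalIntegrable _ _
    rw [Finset.sum_congr rfl hrow, Finset.sum_add_distrib]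
    push_cast
    rw [Finset.mul_sum]
  · intro m _
    exact (continuous_finsetSum _ fun n _ => (hcontE m n).const_mul _).intervalIntegrable _ _

/-- **The double-integral identity** (Ivić (5.8)/(5.11), after Ramachandra): for `u` injective
on `S` and any real `Y`,
`∫_0^Y ∫_0^y |∑_{n∈S} a_n e^{iu_n x}|² dx dy = (Y²/2)∑|a_n|² + iY·H_S(a,a)
   - ∑_{m≠n} a_m ā_n (e^{i(u_m-u_n)Y} - 1)/(u_m-u_n)²`. [cite: Ivic1985, (5.8)] -/
theorem doubleIntegral_eq (S : Finset ℕ) (u : ℕ → ℝ) (hu : Set.InjOn u S) (a : ℕ → ℂ)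
    (Y : ℝ) :
    ((∫ y in (0 : ℝ)..Y, ∫ x in (0 : ℝ)..y,
        ‖∑ n ∈ S, a n * cexp (↑(u n) * I * ↑x)‖ ^ 2 : ℝ) : ℂ) =
      ((Y ^ 2 / 2 * ∑ n ∈ S, ‖a n‖ ^ 2 : ℝ) : ℂ)
        + I * Y * ∑ m ∈ S, ∑ n ∈ S.erase m, a m * conj (a n) / ((u m - u n : ℝ) : ℂ)
        - ∑ m ∈ S, ∑ n ∈ S.erase m,
            a m * conj (a n) * (cexp (↑(u m - u n) * I * ↑Y) - 1) / (((u m - u n) ^ 2 : ℝ) : ℂ) := by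
  classical
  -- the primitive of the inner integral of the phase `e^{i(u_m-u_n)x}`
  set φ : ℕ → ℕ → ℝ → ℂ := fun m n y =>
    if m = n then (y : ℂ) else (cexp (↑(u m - u n) * I * ↑y) - 1) / (↑(u m - u n) * I) with hφ
  set Φ : ℕ → ℕ → ℂ := fun m n =>
    if m = n then ((Y ^ 2 / 2 : ℝ) : ℂ)
    else ((cexp (↑(u m - u n) * I * ↑Y) - 1) / (↑(u m - u n) * I) - Y) / (↑(u m - u n) * I) with hΦ
  have hc : ∀ m ∈ S, ∀ n ∈ S, m ≠ n → u m - u n ≠ 0 := fun m hm n hn hmn =>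
    sub_ne_zero.mpr fun h => hmn (hu hm hn h)
  have hcontE : ∀ m n, Continuous fun x : ℝ => cexp (↑(u m - u n) * I * ↑x) := fun m n => by
    fun_prop
  -- Step 1: the inner integral
  have hinner : ∀ y : ℝ,
      ((∫ x in (0 : ℝ)..y, ‖∑ n ∈ S, a n * cexp (↑(u n) * I * ↑x)‖ ^ 2 : ℝ) : ℂ) =
        ∑ m ∈ S, ∑ n ∈ S, a m * conj (a n) * φ m n y := by
    intro y
    rw [← intervalIntegral.integral_ofReal]
    simp_rw [norm_sq_sum_exp_expand]
    rw [intervalIntegral.integral_finsetSum]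
    · refine Finset.sum_congr rfl fun m hm => ?_
      rw [intervalIntegral.integral_finsetSum]
      · refine Finset.sum_congr rfl fun n hn => ?_
        rw [intervalIntegral.integral_const_mul]
        congr 1
        by_cases hmn : m = n
        · subst hmn
          simp [hφ]
        · simp only [hφ, if_neg hmn]
          exact integral_exp_I_mul (hc m hm n hn hmn) y
      · intro n _
        exact ((hcontE m n).const_mul _).intervalIntegrable _ _
    · intro m _
      exact (continuous_finsetSum _ fun n _ => (hcontE m n).const_mul _).intervalIntegrable _ _
  -- continuity of `φ m n`
  have hcontφ : ∀ m n, Continuous (φ m n) := by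
    intro m n
    by_cases hmn : m = n
    · simp only [hφ, if_pos hmn]; fun_prop
    · simp only [hφ, if_neg hmn]; fun_prop
  -- Step 2: the outer integral
  have houter : ((∫ y in (0 : ℝ)..Y, ∫ x in (0 : ℝ)..y,
      ‖∑ n ∈ S, a n * cexp (↑(u n) * I * ↑x)‖ ^ 2 : ℝ) : ℂ) =
        ∑ m ∈ S, ∑ n ∈ S, a m * conj (a n) * Φ m n := by
    rw [← intervalIntegral.integral_ofReal]
    simp_rw [hinner]
    rw [intervalIntegral.integral_finsetSum]
    · refine Finset.sum_congr rfl fun m hm => ?_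
      rw [intervalIntegral.integral_finsetSum]
      · refine Finset.sum_congr rfl fun n hn => ?_
        rw [intervalIntegral.integral_const_mul]
        congr 1
        by_cases hmn : m = n
        · subst hmn
          simp only [hφ, hΦ, if_pos rfl]
          rw [intervalIntegral.integral_ofReal, integral_id]
          push_cast; ring
        · simp only [hφ, hΦ, if_neg hmn]
          exact integral_integral_exp_I_mul (hc m hm n hn hmn) Y
      · intro n _
        exact ((hcontφ m n).const_mul _).intervalIntegrable _ _
    · intro m _
      exact (continuous_finsetSum _ fun n _ => (hcontφ m n).const_mul _).intervalIntegrable _ _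
  -- Step 3: algebra
  rw [houter]
  have hsplit : ∀ m ∈ S, ∑ n ∈ S, a m * conj (a n) * Φ m n =
      ((Y ^ 2 / 2 * ‖a m‖ ^ 2 : ℝ) : ℂ) +
        ∑ n ∈ S.erase m, (I * Y * (a m * conj (a n) / ((u m - u n : ℝ) : ℂ)) -
          a m * conj (a n) * (cexp (↑(u m - u n) * I * ↑Y) - 1) / (((u m - u n) ^ 2 : ℝ) : ℂ)) := by
    intro m hm
    rw [← Finset.add_sum_erase S _ hm]
    congr 1
    · simp only [hΦ, if_pos rfl, Complex.mul_conj, Complex.normSq_eq_norm_sq]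
      push_cast; ring
    · refine Finset.sum_congr rfl fun n hn => ?_
      have hnm : m ≠ n := fun h => (Finset.mem_erase.mp hn).1 h.symm
      simp only [hΦ, if_neg hnm]
      rw [offDiag_algebra (hc m hm n (Finset.mem_of_mem_erase hn) hnm)]
      ring
  rw [Finset.sum_congr rfl hsplit, Finset.sum_add_distrib]
  simp only [Finset.sum_sub_distrib, Finset.mul_sum]
  push_cast
  ring

/-- **One-sided bound from positivity** (Ivić (5.8), (5.11)): for `u` injective on `S` and `Y ≥ 0`,
`Y · Im H_S(a,a) ≤ (Y²/2) ∑|a_n|² - Re ∑_{m≠n} a_m ā_n (e^{i(u_m-u_n)Y} - 1)/(u_m-u_n)²`.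
[cite: Ivic1985, (5.11)] -/
theorem im_hilbertForm_le (S : Finset ℕ) (u : ℕ → ℝ) (hu : Set.InjOn u S) (a : ℕ → ℂ) {Y : ℝ}
    (hY : 0 ≤ Y) :
    Y * (∑ m ∈ S, ∑ n ∈ S.erase m, a m * conj (a n) / ((u m - u n : ℝ) : ℂ)).im ≤
      Y ^ 2 / 2 * ∑ n ∈ S, ‖a n‖ ^ 2 -
      (∑ m ∈ S, ∑ n ∈ S.erase m,
        a m * conj (a n) * (cexp (↑(u m - u n) * I * ↑Y) - 1) / (((u m - u n) ^ 2 : ℝ) : ℂ)).re := by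
  have hJ : 0 ≤ ∫ y in (0 : ℝ)..Y, ∫ x in (0 : ℝ)..y,
      ‖∑ n ∈ S, a n * cexp (↑(u n) * I * ↑x)‖ ^ 2 :=
    intervalIntegral.integral_nonneg hY fun y hy =>
      intervalIntegral.integral_nonneg hy.1 fun x _ => by positivity
  have h := congrArg Complex.re (doubleIntegral_eq S u hu a Y)
  rw [Complex.ofReal_re, Complex.sub_re, Complex.add_re, Complex.ofReal_re] at h
  have hI : (I * ↑Y * ∑ m ∈ S, ∑ n ∈ S.erase m, a m * conj (a n) / ((u m - u n : ℝ) : ℂ)).re =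
      -(Y * (∑ m ∈ S, ∑ n ∈ S.erase m, a m * conj (a n) / ((u m - u n : ℝ) : ℂ)).im) := by
    simp [Complex.mul_re, Complex.mul_im]
  linarith

/-- `H_S(ā, ā) = -H_S(a, a)` (swap `m ↔ n`; the kernel is real and antisymmetric). [folklore] -/
theorem hilbertForm_conj_conj (S : Finset ℕ) (u : ℕ → ℝ) (a : ℕ → ℂ) :
    ∑ m ∈ S, ∑ n ∈ S.erase m, conj (a m) * conj (conj (a n)) / ((u m - u n : ℝ) : ℂ) =
      -∑ m ∈ S, ∑ n ∈ S.erase m, a m * conj (a n) / ((u m - u n : ℝ) : ℂ) := by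
  simp only [Complex.conj_conj]
  rw [sum_erase_comm]
  simp only [← Finset.sum_neg_distrib]
  refine Finset.sum_congr rfl fun n _ => Finset.sum_congr rfl fun m _ => ?_
  rw [← div_neg]
  push_cast
  ring

/-- `conj H_S(a,a) = -H_S(a,a)`: the Hilbert form is purely imaginary on the diagonal.
[folklore] -/
theorem conj_hilbertForm (S : Finset ℕ) (u : ℕ → ℝ) (a : ℕ → ℂ) :
    conj (∑ m ∈ S, ∑ n ∈ S.erase m, a m * conj (a n) / ((u m - u n : ℝ) : ℂ)) =
      -∑ m ∈ S, ∑ n ∈ S.erase m, a m * conj (a n) / ((u m - u n : ℝ) : ℂ) := by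
  rw [← hilbertForm_conj_conj]
  simp only [map_sum, map_div₀, map_mul, Complex.conj_conj, Complex.conj_ofReal]

/-- `Re H_S(a,a) = 0`. [folklore] -/
theorem re_hilbertForm (S : Finset ℕ) (u : ℕ → ℝ) (a : ℕ → ℂ) :
    (∑ m ∈ S, ∑ n ∈ S.erase m, a m * conj (a n) / ((u m - u n : ℝ) : ℂ)).re = 0 := by
  have h := congrArg Complex.re (conj_hilbertForm S u a)
  rw [Complex.conj_re, Complex.neg_re] at h
  linarith

/-- `‖H_S(a,a)‖ = |Im H_S(a,a)|`. [folklore] -/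
theorem norm_hilbertForm_eq_abs_im (S : Finset ℕ) (u : ℕ → ℝ) (a : ℕ → ℂ) :
    ‖∑ m ∈ S, ∑ n ∈ S.erase m, a m * conj (a n) / ((u m - u n : ℝ) : ℂ)‖ =
      |(∑ m ∈ S, ∑ n ∈ S.erase m, a m * conj (a n) / ((u m - u n : ℝ) : ℂ)).im| := by
  have hre := re_hilbertForm S u a
  set H := ∑ m ∈ S, ∑ n ∈ S.erase m, a m * conj (a n) / ((u m - u n : ℝ) : ℂ) with hH
  have h : H = (H.im : ℂ) * I := Complex.ext (by simp [hre]) (by simp)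
  rw [h, norm_mul, Complex.norm_I, mul_one, Complex.norm_real, Real.norm_eq_abs]
  simp

/-- Termwise bound for the remainder: `|a_m ā_n (e^{icY} - 1)/c²| ≤ 2 |a_m| |a_n| / c²`.
[folklore] -/
lemma norm_remainder_term_le (am an : ℂ) (c Y : ℝ) :
    ‖am * conj an * (cexp (↑c * I * ↑Y) - 1) / ((c ^ 2 : ℝ) : ℂ)‖ ≤ 2 * (‖am‖ * ‖an‖ / c ^ 2) := by
  rw [norm_div, norm_mul, norm_mul, Complex.norm_conj, Complex.norm_real, Real.norm_eq_abs,
    abs_of_nonneg (sq_nonneg c)]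
  have h1 : ‖cexp (↑c * I * ↑Y) - 1‖ ≤ 2 := by
    refine (norm_sub_le _ _).trans ?_
    rw [show (c : ℂ) * I * Y = ((c * Y : ℝ) : ℂ) * I by push_cast; ring,
      Complex.norm_exp_ofReal_mul_I, norm_one]
    norm_num
  rcases eq_or_ne c 0 with rfl | hc
  · simp
  · have hc2 : 0 < c ^ 2 := by positivity
    rw [div_le_iff₀ hc2]
    calc ‖am‖ * ‖an‖ * ‖cexp (↑c * I * ↑Y) - 1‖ ≤ ‖am‖ * ‖an‖ * 2 := by gcongr
      _ = 2 * (‖am‖ * ‖an‖ / c ^ 2) * c ^ 2 := by field_simp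

/-- The remainder is bounded by `2 ∑_{m≠n} |a_m||a_n|/(u_m-u_n)²`. [folklore] -/
theorem norm_remainder_le (S : Finset ℕ) (u : ℕ → ℝ) (a : ℕ → ℂ) (Y : ℝ) :
    ‖∑ m ∈ S, ∑ n ∈ S.erase m,
        a m * conj (a n) * (cexp (↑(u m - u n) * I * ↑Y) - 1) / (((u m - u n) ^ 2 : ℝ) : ℂ)‖ ≤
      2 * ∑ m ∈ S, ∑ n ∈ S.erase m, ‖a m‖ * ‖a n‖ / (u m - u n) ^ 2 := by
  rw [Finset.mul_sum]
  refine (norm_sum_le _ _).trans (Finset.sum_le_sum fun m _ => ?_)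
  rw [Finset.mul_sum]
  refine (norm_sum_le _ _).trans (Finset.sum_le_sum fun n _ => ?_)
  exact norm_remainder_term_le (a m) (a n) (u m - u n) Y

/-- Schur's test for the symmetric kernel `1/(u_m-u_n)²`:
`∑_{m≠n} |a_m||a_n|/(u_m-u_n)² ≤ ∑_m |a_m|² ∑_{n≠m} 1/(u_m-u_n)²`. [folklore] -/
theorem sum_sum_norm_mul_div_sq_le (S : Finset ℕ) (u : ℕ → ℝ) (a : ℕ → ℂ) :
    ∑ m ∈ S, ∑ n ∈ S.erase m, ‖a m‖ * ‖a n‖ / (u m - u n) ^ 2 ≤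
      ∑ m ∈ S, ‖a m‖ ^ 2 * ∑ n ∈ S.erase m, 1 / (u m - u n) ^ 2 := by
  have hpt : ∀ m n, ‖a m‖ * ‖a n‖ / (u m - u n) ^ 2 ≤
      ‖a m‖ ^ 2 / 2 * (1 / (u m - u n) ^ 2) + ‖a n‖ ^ 2 / 2 * (1 / (u n - u m) ^ 2) := by
    intro m n
    have h2 : (u n - u m) ^ 2 = (u m - u n) ^ 2 := by ring
    rw [h2, ← add_mul, div_eq_mul_one_div (‖a m‖ * ‖a n‖)]
    gcongr
    nlinarith [sq_nonneg (‖a m‖ - ‖a n‖)]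
  calc ∑ m ∈ S, ∑ n ∈ S.erase m, ‖a m‖ * ‖a n‖ / (u m - u n) ^ 2
      ≤ ∑ m ∈ S, ∑ n ∈ S.erase m,
          (‖a m‖ ^ 2 / 2 * (1 / (u m - u n) ^ 2) + ‖a n‖ ^ 2 / 2 * (1 / (u n - u m) ^ 2)) :=
        Finset.sum_le_sum fun m _ => Finset.sum_le_sum fun n _ => hpt m n
    _ = ∑ m ∈ S, ∑ n ∈ S.erase m, ‖a m‖ ^ 2 / 2 * (1 / (u m - u n) ^ 2) +
          ∑ m ∈ S, ∑ n ∈ S.erase m, ‖a n‖ ^ 2 / 2 * (1 / (u n - u m) ^ 2) := by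
        rw [← Finset.sum_add_distrib]
        exact Finset.sum_congr rfl fun m _ => Finset.sum_add_distrib
    _ = ∑ m ∈ S, ∑ n ∈ S.erase m, ‖a m‖ ^ 2 / 2 * (1 / (u m - u n) ^ 2) +
          ∑ n ∈ S, ∑ m ∈ S.erase n, ‖a n‖ ^ 2 / 2 * (1 / (u n - u m) ^ 2) := by
        rw [sum_erase_comm S (fun m n => ‖a n‖ ^ 2 / 2 * (1 / (u n - u m) ^ 2))]
    _ = ∑ m ∈ S, ‖a m‖ ^ 2 * ∑ n ∈ S.erase m, 1 / (u m - u n) ^ 2 := by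
        rw [← Finset.sum_add_distrib]
        refine Finset.sum_congr rfl fun m _ => ?_
        rw [← Finset.sum_add_distrib, Finset.mul_sum]
        refine Finset.sum_congr rfl fun n _ => ?_
        ring

/-- `∑_{n ∈ S, n ≠ m} 1/(m-n)² ≤ 4` for naturals. [folklore] -/
lemma sum_inv_sq_natSub_le (S : Finset ℕ) (m : ℕ) :
    ∑ n ∈ S.erase m, 1 / ((m : ℝ) - n) ^ 2 ≤ 4 := by
  classical
  have hbasic : ∀ K : ℕ, ∑ j ∈ Finset.Ioo 0 K, 1 / ((j : ℝ)) ^ 2 ≤ 2 := by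
    intro K
    have h := sum_Ioo_inv_sq_le (α := ℝ) 0 K
    norm_num at h
    simpa [one_div] using h
  set A := (S.erase m).filter (· < m) with hA
  set B := (S.erase m).filter (m < ·) with hB
  have hsplit : S.erase m = A ∪ B := by
    ext n
    simp only [hA, hB, Finset.mem_union, Finset.mem_filter, Finset.mem_erase]
    constructor
    · rintro ⟨hne, hn⟩
      rcases lt_or_gt_of_ne hne with h | h
      · exact Or.inl ⟨⟨hne, hn⟩, h⟩
      · exact Or.inr ⟨⟨hne, hn⟩, h⟩
    · rintro (⟨h, _⟩ | ⟨h, _⟩) <;> exact h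
  have hdisj : Disjoint A B := by
    rw [Finset.disjoint_left]
    intro n hnA hnB
    simp only [hA, hB, Finset.mem_filter] at hnA hnB
    omega
  -- the part `n < m`
  have h1 : ∑ n ∈ A, 1 / ((m : ℝ) - n) ^ 2 ≤ 2 := by
    have hinj : Set.InjOn (fun n : ℕ => m - n) A := by
      intro x hx y hy hxy
      simp only [hA, Finset.coe_filter, Set.mem_setOf_eq] at hx hy
      simp only at hxy
      omega
    calc ∑ n ∈ A, 1 / ((m : ℝ) - n) ^ 2 = ∑ j ∈ A.image (fun n => m - n), 1 / ((j : ℝ)) ^ 2 := by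
          rw [Finset.sum_image hinj]
          refine Finset.sum_congr rfl fun n hn => ?_
          simp only [hA, Finset.mem_filter] at hn
          rw [Nat.cast_sub hn.2.le]
      _ ≤ ∑ j ∈ Finset.Ioo 0 (m + 1), 1 / ((j : ℝ)) ^ 2 := by
          refine Finset.sum_le_sum_of_subset_of_nonneg ?_ fun j _ _ => by positivity
          intro j hj
          simp only [Finset.mem_image, hA, Finset.mem_filter] at hj
          obtain ⟨n, ⟨_, hn⟩, rfl⟩ := hj
          simp only [Finset.mem_Ioo]
          omega
      _ ≤ 2 := hbasic _
  -- the part `m < n`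
  have h2 : ∑ n ∈ B, 1 / ((m : ℝ) - n) ^ 2 ≤ 2 := by
    have hinj : Set.InjOn (fun n : ℕ => n - m) B := by
      intro x hx y hy hxy
      simp only [hB, Finset.coe_filter, Set.mem_setOf_eq] at hx hy
      simp only at hxy
      omega
    set K := S.sup id + 1 with hK
    calc ∑ n ∈ B, 1 / ((m : ℝ) - n) ^ 2 = ∑ j ∈ B.image (fun n => n - m), 1 / ((j : ℝ)) ^ 2 := by
          rw [Finset.sum_image hinj]
          refine Finset.sum_congr rfl fun n hn => ?_
          simp only [hB, Finset.mem_filter] at hn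
          rw [Nat.cast_sub hn.2.le]
          ring
      _ ≤ ∑ j ∈ Finset.Ioo 0 K, 1 / ((j : ℝ)) ^ 2 := by
          refine Finset.sum_le_sum_of_subset_of_nonneg ?_ fun j _ _ => by positivity
          intro j hj
          simp only [Finset.mem_image, hB, Finset.mem_filter, Finset.mem_erase] at hj
          obtain ⟨n, ⟨⟨_, hnS⟩, hn⟩, rfl⟩ := hj
          have hnK : n ≤ S.sup id := Finset.le_sup (f := id) hnS
          simp only [Finset.mem_Ioo]
          omega
      _ ≤ 2 := hbasic _
  rw [hsplit, Finset.sum_union hdisj]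
  linarith

/-- Under the separation hypothesis `δ|m-n| ≤ |u_m-u_n|`:
`∑_{n∈S, n≠m} 1/(u_m-u_n)² ≤ 4/δ²`. [folklore] -/
lemma sum_inv_sq_le_of_separated (S : Finset ℕ) (u : ℕ → ℝ) {δ : ℝ} (hδ : 0 < δ)
    (hsep : ∀ m ∈ S, ∀ n ∈ S, δ * |(m : ℝ) - n| ≤ |u m - u n|) {m : ℕ} (hm : m ∈ S) :
    ∑ n ∈ S.erase m, 1 / (u m - u n) ^ 2 ≤ 4 / δ ^ 2 := by
  have hpt : ∀ n ∈ S.erase m, 1 / (u m - u n) ^ 2 ≤ (1 / δ ^ 2) * (1 / ((m : ℝ) - n) ^ 2) := by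
    intro n hn
    obtain ⟨hnm, hnS⟩ := Finset.mem_erase.mp hn
    have hmn : (0 : ℝ) < |(m : ℝ) - n| := by
      rw [abs_pos, sub_ne_zero]
      exact_mod_cast (Ne.symm hnm)
    have h := hsep m hm n hnS
    have hpos : 0 < δ * |(m : ℝ) - n| := mul_pos hδ hmn
    rw [← abs_sq, ← sq_abs (u m - u n), ← sq_abs ((m : ℝ) - n), abs_pow, sq_abs,
      one_div_mul_one_div, ← mul_pow]
    gcongr
  calc ∑ n ∈ S.erase m, 1 / (u m - u n) ^ 2
      ≤ ∑ n ∈ S.erase m, (1 / δ ^ 2) * (1 / ((m : ℝ) - n) ^ 2) := Finset.sum_le_sum hpt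
    _ = (1 / δ ^ 2) * ∑ n ∈ S.erase m, 1 / ((m : ℝ) - n) ^ 2 := by rw [Finset.mul_sum]
    _ ≤ (1 / δ ^ 2) * 4 := by gcongr; exact sum_inv_sq_natSub_le S m
    _ = 4 / δ ^ 2 := by ring

/-- The remainder under separation: `‖R_Y(a)‖ ≤ (8/δ²) ∑ |a_n|²`. [folklore] -/
theorem norm_remainder_le_of_separated (S : Finset ℕ) (u : ℕ → ℝ) {δ : ℝ} (hδ : 0 < δ)
    (hsep : ∀ m ∈ S, ∀ n ∈ S, δ * |(m : ℝ) - n| ≤ |u m - u n|) (a : ℕ → ℂ) (Y : ℝ) :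
    ‖∑ m ∈ S, ∑ n ∈ S.erase m,
        a m * conj (a n) * (cexp (↑(u m - u n) * I * ↑Y) - 1) / (((u m - u n) ^ 2 : ℝ) : ℂ)‖ ≤
      8 / δ ^ 2 * ∑ n ∈ S, ‖a n‖ ^ 2 := by
  refine (norm_remainder_le S u a Y).trans ?_
  refine (mul_le_mul_of_nonneg_left (sum_sum_norm_mul_div_sq_le S u a) (by norm_num)).trans ?_
  rw [show 8 / δ ^ 2 * ∑ n ∈ S, ‖a n‖ ^ 2 = 2 * ∑ n ∈ S, ‖a n‖ ^ 2 * (4 / δ ^ 2) by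
    rw [← Finset.sum_mul]; ring]
  gcongr with m hm
  exact sum_inv_sq_le_of_separated S u hδ hsep hm

end HilbertIneq

open HilbertIneq in
/-- **Hilbert's inequality for separated sequences** (cf. Ivić 1985 (5.6), where `u_n = q_n` are
distinct integers and the constant is `π`; Montgomery–Vaughan 1974, Thm 1, constant `π/δ` for
`δ`-spaced reals): if `δ > 0` and `δ|m - n| ≤ |u_m - u_n|` for all `m, n ∈ S`, then
`|∑_{m∈S} ∑_{n∈S, n≠m} a_m ā_n/(u_m - u_n)| ≤ (4/δ) ∑_{n∈S} |a_n|²`.  PROVED (elementary constant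
`4`, not the sharp `π`). [cite: Ivic1985, (5.6)] -/
theorem hilbertInequality_of_separated (S : Finset ℕ) (u : ℕ → ℝ) (a : ℕ → ℂ) {δ : ℝ}
    (hδ : 0 < δ) (hsep : ∀ m ∈ S, ∀ n ∈ S, δ * |(m : ℝ) - n| ≤ |u m - u n|) :
    ‖∑ m ∈ S, ∑ n ∈ S.erase m, a m * conj (a n) / ((u m - u n : ℝ) : ℂ)‖ ≤
      4 / δ * ∑ n ∈ S, ‖a n‖ ^ 2 := by
  have hu := injOn_of_separated S u hδ hsep
  set A := ∑ n ∈ S, ‖a n‖ ^ 2 with hA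
  set Y : ℝ := 4 / δ with hYdef
  have hY : 0 < Y := by positivity
  -- one side, for `a`
  have h1 := im_hilbertForm_le S u hu a hY.le
  have hR1 := norm_remainder_le_of_separated S u hδ hsep a Y
  have k1 := (neg_le_abs _).trans ((Complex.abs_re_le_norm _).trans hR1)
  -- other side, for `conj ∘ a`
  have h2 := im_hilbertForm_le S u hu (fun n => conj (a n)) hY.le
  have hR2 := norm_remainder_le_of_separated S u hδ hsep (fun n => conj (a n)) Y
  have k2 := (neg_le_abs _).trans ((Complex.abs_re_le_norm _).trans hR2)
  simp only [Complex.norm_conj] at h2 k2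
  rw [hilbertForm_conj_conj, Complex.neg_im] at h2
  have hYid : (Y ^ 2 / 2 + 8 / δ ^ 2) * A = Y * (4 / δ * A) := by
    simp only [hYdef]
    field_simp
    ring
  have hup : Y * (∑ m ∈ S, ∑ n ∈ S.erase m, a m * conj (a n) / ((u m - u n : ℝ) : ℂ)).im ≤
      Y * (4 / δ * A) := by
    rw [← hYid]; linarith
  have hlo : Y * (-(∑ m ∈ S, ∑ n ∈ S.erase m, a m * conj (a n) / ((u m - u n : ℝ) : ℂ)).im) ≤
      Y * (4 / δ * A) := by
    rw [← hYid]; linarith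
  rw [norm_hilbertForm_eq_abs_im, abs_le]
  constructor
  · linarith [le_of_mul_le_mul_left hlo hY]
  · exact le_of_mul_le_mul_left hup hY

/-- **Polarisation identity** for the Hilbert form `H(a,b) = ∑_{m≠n} a_m conj(b_n)/(u_m-u_n)`:
`4 H(a,b) = H(a+b) - H(a-b) + i H(a+ib) - i H(a-ib)` with `H(x) = H(x,x)`. [folklore] -/
theorem hilbertForm_polarization (S : Finset ℕ) (u : ℕ → ℝ) (a b : ℕ → ℂ) :
    ∑ m ∈ S, ∑ n ∈ S.erase m, a m * conj (b n) / ((u m - u n : ℝ) : ℂ) =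
      (1 / 4) * (∑ m ∈ S, ∑ n ∈ S.erase m, (a + b) m * conj ((a + b) n) / ((u m - u n : ℝ) : ℂ)
      - ∑ m ∈ S, ∑ n ∈ S.erase m, (a - b) m * conj ((a - b) n) / ((u m - u n : ℝ) : ℂ)
      + I * ∑ m ∈ S, ∑ n ∈ S.erase m, (a + I • b) m * conj ((a + I • b) n) / ((u m - u n : ℝ) : ℂ)
      - I * ∑ m ∈ S, ∑ n ∈ S.erase m,
          (a - I • b) m * conj ((a - I • b) n) / ((u m - u n : ℝ) : ℂ)) := by
  simp only [Finset.mul_sum, ← Finset.sum_sub_distrib, ← Finset.sum_add_distrib]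
  refine Finset.sum_congr rfl fun m _ => Finset.sum_congr rfl fun n _ => ?_
  simp only [Pi.add_apply, Pi.sub_apply, Pi.smul_apply, smul_eq_mul, map_add, map_sub, map_mul,
    Complex.conj_I, div_eq_mul_inv]
  linear_combination ((a m * conj (b n) - b m * conj (a n)) * ((u m - u n : ℝ) : ℂ)⁻¹ / 2) *
    Complex.I_sq

open HilbertIneq in
/-- **Bilinear Hilbert inequality for separated sequences** (cf. Ivić 1985 (5.10), constant `3π`
for distinct integers): under `δ|m-n| ≤ |u_m-u_n|` on `S`,
`|∑_{m∈S} ∑_{n∈S, n≠m} a_m conj(b_n)/(u_m-u_n)| ≤ (8/δ)(∑_{n∈S}|a_n|² + ∑_{n∈S}|b_n|²)`.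
PROVED, by polarisation from `hilbertInequality_of_separated`. [cite: Ivic1985, (5.10)] -/
theorem norm_hilbertForm_le_of_separated (S : Finset ℕ) (u : ℕ → ℝ) (a b : ℕ → ℂ) {δ : ℝ}
    (hδ : 0 < δ) (hsep : ∀ m ∈ S, ∀ n ∈ S, δ * |(m : ℝ) - n| ≤ |u m - u n|) :
    ‖∑ m ∈ S, ∑ n ∈ S.erase m, a m * conj (b n) / ((u m - u n : ℝ) : ℂ)‖ ≤
      8 / δ * (∑ n ∈ S, ‖a n‖ ^ 2 + ∑ n ∈ S, ‖b n‖ ^ 2) := by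
  have hH := fun c : ℕ → ℂ => hilbertInequality_of_separated S u c hδ hsep
  have hδ4 : 0 ≤ 4 / δ := by positivity
  -- `‖x + y‖² ≤ 2‖x‖² + 2‖y‖²`
  have norm_add_sq_le_two_mul : ∀ x y : ℂ, ‖x + y‖ ^ 2 ≤ 2 * ‖x‖ ^ 2 + 2 * ‖y‖ ^ 2 := by
    intro x y
    have h := norm_add_le x y
    nlinarith [sq_nonneg (‖x‖ - ‖y‖), norm_nonneg (x + y), norm_nonneg x, norm_nonneg y]
  rw [hilbertForm_polarization]
  set H : (ℕ → ℂ) → ℂ := fun c =>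
    ∑ m ∈ S, ∑ n ∈ S.erase m, c m * conj (c n) / ((u m - u n : ℝ) : ℂ) with hHdef
  have e1 : ‖H (a + b)‖ ≤ 4 / δ * ∑ n ∈ S, ‖(a + b) n‖ ^ 2 := hH (a + b)
  have e2 : ‖H (a - b)‖ ≤ 4 / δ * ∑ n ∈ S, ‖(a - b) n‖ ^ 2 := hH (a - b)
  have e3 : ‖H (a + I • b)‖ ≤ 4 / δ * ∑ n ∈ S, ‖(a + I • b) n‖ ^ 2 := hH (a + I • b)
  have e4 : ‖H (a - I • b)‖ ≤ 4 / δ * ∑ n ∈ S, ‖(a - I • b) n‖ ^ 2 := hH (a - I • b)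
  -- bounds on the four norms squared sums
  have s1 : ∑ n ∈ S, ‖(a + b) n‖ ^ 2 ≤ 2 * ∑ n ∈ S, ‖a n‖ ^ 2 + 2 * ∑ n ∈ S, ‖b n‖ ^ 2 := by
    rw [Finset.mul_sum, Finset.mul_sum, ← Finset.sum_add_distrib]
    exact Finset.sum_le_sum fun n _ => by simpa using norm_add_sq_le_two_mul (a n) (b n)
  have s2 : ∑ n ∈ S, ‖(a - b) n‖ ^ 2 ≤ 2 * ∑ n ∈ S, ‖a n‖ ^ 2 + 2 * ∑ n ∈ S, ‖b n‖ ^ 2 := by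
    rw [Finset.mul_sum, Finset.mul_sum, ← Finset.sum_add_distrib]
    refine Finset.sum_le_sum fun n _ => ?_
    have := norm_add_sq_le_two_mul (a n) (-b n)
    simpa [sub_eq_add_neg] using this
  have s3 : ∑ n ∈ S, ‖(a + I • b) n‖ ^ 2 ≤ 2 * ∑ n ∈ S, ‖a n‖ ^ 2 + 2 * ∑ n ∈ S, ‖b n‖ ^ 2 := by
    rw [Finset.mul_sum, Finset.mul_sum, ← Finset.sum_add_distrib]
    refine Finset.sum_le_sum fun n _ => ?_
    have := norm_add_sq_le_two_mul (a n) (I * b n)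
    simpa using this
  have s4 : ∑ n ∈ S, ‖(a - I • b) n‖ ^ 2 ≤ 2 * ∑ n ∈ S, ‖a n‖ ^ 2 + 2 * ∑ n ∈ S, ‖b n‖ ^ 2 := by
    rw [Finset.mul_sum, Finset.mul_sum, ← Finset.sum_add_distrib]
    refine Finset.sum_le_sum fun n _ => ?_
    have := norm_add_sq_le_two_mul (a n) (-(I * b n))
    simpa [sub_eq_add_neg] using this
  have hA : 0 ≤ ∑ n ∈ S, ‖a n‖ ^ 2 := Finset.sum_nonneg fun n _ => by positivity
  have hB : 0 ≤ ∑ n ∈ S, ‖b n‖ ^ 2 := Finset.sum_nonneg fun n _ => by positivity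
  calc ‖(1 / 4 : ℂ) * (H (a + b) - H (a - b) + I * H (a + I • b) - I * H (a - I • b))‖
      ≤ (1 / 4) * (‖H (a + b)‖ + ‖H (a - b)‖ + ‖H (a + I • b)‖ + ‖H (a - I • b)‖) := by
        rw [norm_mul]
        have h14 : ‖(1 / 4 : ℂ)‖ = 1 / 4 := by
          rw [show (1 / 4 : ℂ) = ((1 / 4 : ℝ) : ℂ) by push_cast; ring, Complex.norm_real]
          norm_num
        rw [h14]
        gcongr
        refine (norm_sub_le _ _).trans ?_
        rw [norm_mul, Complex.norm_I, one_mul]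
        gcongr
        refine (norm_add_le _ _).trans ?_
        rw [norm_mul, Complex.norm_I, one_mul]
        gcongr
        exact norm_sub_le _ _
    _ ≤ (1 / 4) * (4 * (4 / δ * (2 * ∑ n ∈ S, ‖a n‖ ^ 2 + 2 * ∑ n ∈ S, ‖b n‖ ^ 2))) := by
        gcongr (1 / 4) * ?_
        have f1 := e1.trans (mul_le_mul_of_nonneg_left s1 hδ4)
        have f2 := e2.trans (mul_le_mul_of_nonneg_left s2 hδ4)
        have f3 := e3.trans (mul_le_mul_of_nonneg_left s3 hδ4)
        have f4 := e4.trans (mul_le_mul_of_nonneg_left s4 hδ4)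
        linarith
    _ = 8 / δ * (∑ n ∈ S, ‖a n‖ ^ 2 + ∑ n ∈ S, ‖b n‖ ^ 2) := by
        field_simp
        ring

end Literature.NumberTheory.LFunctions
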